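import Summits.CriticalPhenomena.PercolationContinuityZ3.Theorems.PercNearOneGluingNoHeavyLowerTailSahiGridPatternDiagCertLiteralTwoAnd

/-!
# `NoHeavyLowerTail` (crux stmt-CriticalPhenomena-4575), Sahi programme P1: **THE RELATIVE STEP `glue(V⁰,V⁰,V¹)` (RO) — LEVEL BOOKKEEPING FOR CERTIFICATES** —
# exact section formulas for `λ_A` and `Θ_A`, and the reduction of a level-wise certificate `(2g, 2g, 2h)` to two conditions on `[3]^k`

Support file (Sahi cell, seat `prim-sahi-p1`, generation 33; `--supports stmt-CriticalPhenomena-4575`).  Pure proofs, no definitions, no `sorry`, standard axioms.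
Companion of `…SahiGridPatternRelStepLevels` (the RA step `glue(V⁰,V¹,V¹)`, same generation; same template and tools: `sum_sum_eq_of_latin6_eq`, `latin6_norm`
of `…DiagCertLiteralTwoAnd`, `sum_mem_eq_levels`, `nuCount_glue_eq` of `…DiagCertLiteralAnd`).

THE MATHEMATICS (seat memo FROM-prim-sahi-p1-gen33 §3).  The second relative step of the read-once programme, RO `A = glue(V⁰,V⁰,V¹)` (sections
`1_A(0,z) = 1_A(1,z) = 1_{V⁰}(z)`, `1_A(2,z) = 1_{V¹}(z)`; arbitrary finsets `V⁰, V¹` — nestedness is not needed for the identities):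
* `lamU_relStepRO_levels`: `λ_A(0,q) = λ_A(1,q) = 2^{k+2}1_{V⁰}(q) − ν_{V⁰}(q) − ν_{V¹}(q)`, `λ_A(2,q) = 2^{k+2}1_{V¹}(q) − 2ν_{V⁰}(q)`;
* `sStarD_relStepRO_eq_sections`: `sStarD A B C = Σ_s λ_A-level(B_s∩C_s) − [Θ^{001}(B₀×C₁) + Θ^{001}(B₁×C₀) + Θ^{010}(B₀×C₂) + Θ^{010}(B₁×C₂) + Θ^{100}(B₂×C₀) + Θ^{100}(B₂×C₁)]`
  with the mixed kernels `Θ^{XYZ}(q,r) = [q δ̸ r](X(q)+Y(r)−Z(q̄r))`, `0 = V⁰`, `1 = V¹` — the pairs inside the two `V⁰`-levels see the BIG set at the third point, the pairs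
  with the top level see it at the point lying in the top level (an exact six-role polynomial identity);
* **`diagCert_relStepRO_T`, `diagCert_relStepRO_N`, `sStarD_cylSet_relStepRO_nonneg`**: for `g, h : [3]^k → ℤ` the level-wise vector `d' = (2g, 2g, 2h)` satisfies
  (T') as soon as (T⁼) `2g(W₀) + 2g(W₁) + 2h(W₂) ≤ Σ_s λ_A-level(W_s)` over nested up-set triples, and (N') as soon as (N⁼) the six mixed sums are
  `≤ 2g(B₀∩C₀) + 2g(B₁∩C₁) + 2h(B₂∩C₂)` over pairs of nested up-set triples; with `g, h ≥ 0`, `A` and all its cylinders are then good in every dimension.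
Nothing here asserts the existence of `(g,h)` for any pair, nor `PatternPos d` for `d ≥ 4`. [this work]
-/

namespace Summit.CriticalPhenomena.PercolationContinuityZ3.Theorems.SahiGridPattern

open Finset SahiGrid3
open scoped BigOperators

variable {k : ℕ} {V₀ V₁ : Finset (Pd k)} {A : Finset (Pd (1 + k))}

/-- Sections of an up-set of `[3]^{1+k}` are nested along the free axis (local copy of the RA file's lemma). -/
private theorem sect_subset_sect_of_le' {B : Finset (Pd (1 + k))} (hB : IsUpperSet (B : Set (Pd (1 + k)))) {s t : Fin 3} (hst : s ≤ t) :
    sect B (fun _ : Fin 1 => s) ⊆ sect B (fun _ : Fin 1 => t) := by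
  intro q hq
  unfold sect at hq ⊢
  rw [Finset.mem_filter] at hq ⊢
  exact ⟨hq.1, mem_of_glue_mem_of_le hB hst hq.2⟩

/-- `λ_A` at the three levels of `A = glue(V⁰,V⁰,V¹)`: `λ_A(0,q) = λ_A(1,q) = 2^{k+2}1_{V⁰}(q) − ν_{V⁰}(q) − ν_{V¹}(q)`, `λ_A(2,q) = 2^{k+2}1_{V¹}(q) − 2ν_{V⁰}(q)`
(ν as pair sums). [this work] -/
theorem lamU_relStepRO_levels (i0 : ∀ z, ind A (glue (fun _ => 0) z) = ind V₀ z) (i1 : ∀ z, ind A (glue (fun _ => 1) z) = ind V₀ z)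
    (i2 : ∀ z, ind A (glue (fun _ => 2) z) = ind V₁ z) (q : Pd k) :
    lamU A (glue (fun _ => 0) q) = 2 * 2 ^ (1 + k) * ind V₀ q - (∑ r : Pd k, ind V₀ r * (if TotDist r q = true then (1:ℤ) else 0))
        - ∑ r : Pd k, ind V₁ r * (if TotDist r q = true then (1:ℤ) else 0)
    ∧ lamU A (glue (fun _ => 1) q) = 2 * 2 ^ (1 + k) * ind V₀ q - (∑ r : Pd k, ind V₀ r * (if TotDist r q = true then (1:ℤ) else 0))
        - ∑ r : Pd k, ind V₁ r * (if TotDist r q = true then (1:ℤ) else 0)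
    ∧ lamU A (glue (fun _ => 2) q) = 2 * 2 ^ (1 + k) * ind V₁ q - 2 * ∑ r : Pd k, ind V₀ r * (if TotDist r q = true then (1:ℤ) else 0) := by
  obtain ⟨h00, h11, h22, h01, h02, h10, h12, h20, h21, -, -, -, -, -, -⟩ := pd1_facts
  have e : ∀ ξ : Pd 1, (nuCount A (glue ξ q) : ℤ) =
      ((if TotDist (fun _ : Fin 1 => (0:Fin 3)) ξ = true then (1:ℤ) else 0) + (if TotDist (fun _ : Fin 1 => (1:Fin 3)) ξ = true then (1:ℤ) else 0))
        * (∑ r : Pd k, ind V₀ r * (if TotDist r q = true then (1:ℤ) else 0))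
      + (if TotDist (fun _ : Fin 1 => (2:Fin 3)) ξ = true then (1:ℤ) else 0) * (∑ r : Pd k, ind V₁ r * (if TotDist r q = true then (1:ℤ) else 0)) := by
    intro ξ
    rw [nuCount_glue_eq, sum_pd1]
    simp only [i0, i1, i2]
    ring
  unfold lamU
  refine ⟨?_, ?_, ?_⟩
  · rw [e, i0]; simp only [h00, h10, h20, Bool.false_eq_true, if_false, if_true]; ring
  · rw [e, i1]; simp only [h01, h11, h21, Bool.false_eq_true, if_false, if_true]; ring
  · rw [e, i2]; simp only [h02, h12, h22, Bool.false_eq_true, if_false, if_true]; ring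

/-- **The RO step in sections** (exact, arbitrary finsets): `sStarD A B C = Σ_s λ_A-level(B_s ∩ C_s) − [six mixed-kernel sums]`, all as pair sums over `[3]^k`;
the level pairs `(0,1),(1,0)` carry `Θ^{V⁰V⁰V¹}`, `(0,2),(1,2)` carry `Θ^{V⁰V¹V⁰}`, `(2,0),(2,1)` carry `Θ^{V¹V⁰V⁰}`. [this work] -/
theorem sStarD_relStepRO_eq_sections (i0 : ∀ z, ind A (glue (fun _ => 0) z) = ind V₀ z) (i1 : ∀ z, ind A (glue (fun _ => 1) z) = ind V₀ z)
    (i2 : ∀ z, ind A (glue (fun _ => 2) z) = ind V₁ z) (B C : Finset (Pd (1 + k))) :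
    sStarD A B C
      = (∑ q : Pd k, ∑ r : Pd k, (if TotDist q r = true then (1:ℤ) else 0) *
          ( ind B (glue (fun _ => 0) q) * ind C (glue (fun _ => 0) q) * (4 * ind V₀ q - ind V₀ r - ind V₁ r)
            + ind B (glue (fun _ => 1) q) * ind C (glue (fun _ => 1) q) * (4 * ind V₀ q - ind V₀ r - ind V₁ r)
            + ind B (glue (fun _ => 2) q) * ind C (glue (fun _ => 2) q) * (4 * ind V₁ q - 2 * ind V₀ r) ))
        - (∑ q : Pd k, ∑ r : Pd k, (if TotDist q r = true then (1:ℤ) else 0) *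
          ( ind B (glue (fun _ => 0) q) * ind C (glue (fun _ => 1) r) * (ind V₀ q + ind V₀ r - ind V₁ (thirdPt q r))
            + ind B (glue (fun _ => 1) q) * ind C (glue (fun _ => 0) r) * (ind V₀ q + ind V₀ r - ind V₁ (thirdPt q r))
            + ind B (glue (fun _ => 0) q) * ind C (glue (fun _ => 2) r) * (ind V₀ q + ind V₁ r - ind V₀ (thirdPt q r))
            + ind B (glue (fun _ => 1) q) * ind C (glue (fun _ => 2) r) * (ind V₀ q + ind V₁ r - ind V₀ (thirdPt q r))
            + ind B (glue (fun _ => 2) q) * ind C (glue (fun _ => 0) r) * (ind V₁ q + ind V₀ r - ind V₀ (thirdPt q r))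
            + ind B (glue (fun _ => 2) q) * ind C (glue (fun _ => 1) r) * (ind V₁ q + ind V₀ r - ind V₀ (thirdPt q r)) )) := by
  have L3 := sStarD_eq_pd1_sections A B C
  simp only [i0, i1, i2] at L3
  rw [L3, ← Finset.sum_sub_distrib]
  simp only [← Finset.sum_sub_distrib]
  refine sum_sum_eq_of_latin6_eq _ _ fun q r => ?_
  obtain ⟨t1, t2, t3, t4, t5, c1, c2, c3, c4, c5⟩ := latin6_norm (k := k) q r
  simp only [t1, t2, t3, t4, t5, c1, c2, c3, c4, c5]
  ring

/-- A sum over a section rewritten as an indicator-weighted sum. -/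
private theorem sum_sect_eq' (B : Finset (Pd (1 + k))) (s : Fin 3) (g : Pd k → ℤ) :
    (∑ q ∈ sect B (fun _ : Fin 1 => s), g q) = ∑ q : Pd k, ind B (glue (fun _ => s) q) * g q := by
  rw [sum_mem_eq_sum_ind_mul]
  refine Finset.sum_congr rfl fun q _ => ?_
  rw [ind_sect]

/-- A sum over the intersection of two sections. -/
private theorem sum_sect_inter_eq' (B C : Finset (Pd (1 + k))) (s : Fin 3) (g : Pd k → ℤ) :
    (∑ q ∈ sect B (fun _ : Fin 1 => s) ∩ sect C (fun _ : Fin 1 => s), g q) = ∑ q : Pd k, ind B (glue (fun _ => s) q) * ind C (glue (fun _ => s) q) * g q := by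
  rw [sum_mem_eq_sum_ind_mul]
  refine Finset.sum_congr rfl fun q _ => ?_
  rw [ind_inter_eq_mul, ind_sect, ind_sect]

/-- **(T') for the level-wise vector `(2g,2g,2h)` from the JOINT budget condition (T⁼) on nested up-set triples of `[3]^k`.** [this work] -/
theorem diagCert_relStepRO_T (i0 : ∀ z, ind A (glue (fun _ => 0) z) = ind V₀ z) (i1 : ∀ z, ind A (glue (fun _ => 1) z) = ind V₀ z)
    (i2 : ∀ z, ind A (glue (fun _ => 2) z) = ind V₁ z) (g h : Pd k → ℤ)
    (hT : ∀ W₀ W₁ W₂ : Finset (Pd k), IsUpperSet (W₀ : Set (Pd k)) → IsUpperSet (W₁ : Set (Pd k)) → IsUpperSet (W₂ : Set (Pd k)) →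
      W₀ ⊆ W₁ → W₁ ⊆ W₂ →
      2 * (∑ q ∈ W₀, g q) + 2 * (∑ q ∈ W₁, g q) + 2 * (∑ q ∈ W₂, h q)
        ≤ (∑ q ∈ W₀, (2 * 2 ^ (1 + k) * ind V₀ q - (∑ r : Pd k, ind V₀ r * (if TotDist r q = true then (1:ℤ) else 0))
              - ∑ r : Pd k, ind V₁ r * (if TotDist r q = true then (1:ℤ) else 0)))
          + (∑ q ∈ W₁, (2 * 2 ^ (1 + k) * ind V₀ q - (∑ r : Pd k, ind V₀ r * (if TotDist r q = true then (1:ℤ) else 0))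
              - ∑ r : Pd k, ind V₁ r * (if TotDist r q = true then (1:ℤ) else 0)))
          + (∑ q ∈ W₂, (2 * 2 ^ (1 + k) * ind V₁ q - 2 * ∑ r : Pd k, ind V₀ r * (if TotDist r q = true then (1:ℤ) else 0))))
    (W' : Finset (Pd (1 + k))) (hW' : IsUpperSet (W' : Set (Pd (1 + k)))) :
    (∑ x ∈ W', (fun x => if freeOf x 0 = 2 then 2 * h (cellOf x) else 2 * g (cellOf x)) x) ≤ ∑ x ∈ W', lamU A x := by
  have hl := lamU_relStepRO_levels i0 i1 i2
  have h₀ := hT (sect W' (fun _ => 0)) (sect W' (fun _ => 1)) (sect W' (fun _ => 2)) (isUpperSet_sect hW' _) (isUpperSet_sect hW' _) (isUpperSet_sect hW' _)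
    (sect_subset_sect_of_le' hW' (by decide)) (sect_subset_sect_of_le' hW' (by decide))
  simp only [sum_sect_eq'] at h₀
  rw [sum_mem_eq_levels W' _, sum_mem_eq_levels W' (lamU A)]
  simp only [freeOf_glue, cellOf_glue, show ¬ ((0:Fin 3) = 2) by decide, show ¬ ((1:Fin 3) = 2) by decide, if_false, if_true]
  have e0 : (∑ q : Pd k, ind W' (glue (fun _ => 0) q) * lamU A (glue (fun _ => 0) q))
      = ∑ q : Pd k, ind W' (glue (fun _ => 0) q) * (2 * 2 ^ (1 + k) * ind V₀ q - (∑ r : Pd k, ind V₀ r * (if TotDist r q = true then (1:ℤ) else 0))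
          - ∑ r : Pd k, ind V₁ r * (if TotDist r q = true then (1:ℤ) else 0)) :=
    Finset.sum_congr rfl fun q _ => by rw [(hl q).1]
  have e1 : (∑ q : Pd k, ind W' (glue (fun _ => 1) q) * lamU A (glue (fun _ => 1) q))
      = ∑ q : Pd k, ind W' (glue (fun _ => 1) q) * (2 * 2 ^ (1 + k) * ind V₀ q - (∑ r : Pd k, ind V₀ r * (if TotDist r q = true then (1:ℤ) else 0))
          - ∑ r : Pd k, ind V₁ r * (if TotDist r q = true then (1:ℤ) else 0)) :=
    Finset.sum_congr rfl fun q _ => by rw [(hl q).2.1]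
  have e2 : (∑ q : Pd k, ind W' (glue (fun _ => 2) q) * lamU A (glue (fun _ => 2) q))
      = ∑ q : Pd k, ind W' (glue (fun _ => 2) q) * (2 * 2 ^ (1 + k) * ind V₁ q - 2 * ∑ r : Pd k, ind V₀ r * (if TotDist r q = true then (1:ℤ) else 0)) :=
    Finset.sum_congr rfl fun q _ => by rw [(hl q).2.2]
  have s0 : (∑ q : Pd k, ind W' (glue (fun _ => 0) q) * (2 * g q)) = 2 * ∑ q : Pd k, ind W' (glue (fun _ => 0) q) * g q := by
    rw [Finset.mul_sum]; refine Finset.sum_congr rfl fun q _ => ?_; ring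
  have s1 : (∑ q : Pd k, ind W' (glue (fun _ => 1) q) * (2 * g q)) = 2 * ∑ q : Pd k, ind W' (glue (fun _ => 1) q) * g q := by
    rw [Finset.mul_sum]; refine Finset.sum_congr rfl fun q _ => ?_; ring
  have s2 : (∑ q : Pd k, ind W' (glue (fun _ => 2) q) * (2 * h q)) = 2 * ∑ q : Pd k, ind W' (glue (fun _ => 2) q) * h q := by
    rw [Finset.mul_sum]; refine Finset.sum_congr rfl fun q _ => ?_; ring
  rw [e0, e1, e2, s0, s1, s2]
  exact h₀

/-- **(N') for the level-wise vector `(2g,2g,2h)` from the mixed-kernel condition (N⁼) on pairs of nested up-set triples of `[3]^k`.** [this work] -/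
theorem diagCert_relStepRO_N (i0 : ∀ z, ind A (glue (fun _ => 0) z) = ind V₀ z) (i1 : ∀ z, ind A (glue (fun _ => 1) z) = ind V₀ z)
    (i2 : ∀ z, ind A (glue (fun _ => 2) z) = ind V₁ z) (g h : Pd k → ℤ)
    (hN : ∀ B₀ B₁ B₂ C₀ C₁ C₂ : Finset (Pd k), IsUpperSet (B₀ : Set (Pd k)) → IsUpperSet (B₁ : Set (Pd k)) → IsUpperSet (B₂ : Set (Pd k)) →
      IsUpperSet (C₀ : Set (Pd k)) → IsUpperSet (C₁ : Set (Pd k)) → IsUpperSet (C₂ : Set (Pd k)) → B₀ ⊆ B₁ → B₁ ⊆ B₂ → C₀ ⊆ C₁ → C₁ ⊆ C₂ →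
      (∑ q : Pd k, ∑ r : Pd k, (if TotDist q r = true then (1:ℤ) else 0) *
          ( ind B₀ q * ind C₁ r * (ind V₀ q + ind V₀ r - ind V₁ (thirdPt q r))
            + ind B₁ q * ind C₀ r * (ind V₀ q + ind V₀ r - ind V₁ (thirdPt q r))
            + ind B₀ q * ind C₂ r * (ind V₀ q + ind V₁ r - ind V₀ (thirdPt q r))
            + ind B₁ q * ind C₂ r * (ind V₀ q + ind V₁ r - ind V₀ (thirdPt q r))
            + ind B₂ q * ind C₀ r * (ind V₁ q + ind V₀ r - ind V₀ (thirdPt q r))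
            + ind B₂ q * ind C₁ r * (ind V₁ q + ind V₀ r - ind V₀ (thirdPt q r)) ))
        ≤ 2 * (∑ q ∈ B₀ ∩ C₀, g q) + 2 * (∑ q ∈ B₁ ∩ C₁, g q) + 2 * (∑ q ∈ B₂ ∩ C₂, h q))
    (B C : Finset (Pd (1 + k))) (hB : IsUpperSet (B : Set (Pd (1 + k)))) (hC : IsUpperSet (C : Set (Pd (1 + k)))) :
    (∑ x ∈ B, ∑ y ∈ C, thetaVal A x y) ≤ ∑ x ∈ B ∩ C, (fun x => if freeOf x 0 = 2 then 2 * h (cellOf x) else 2 * g (cellOf x)) x := by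
  have hl := lamU_relStepRO_levels i0 i1 i2
  have eS := sStarD_eq_sum_lamU_sub_sum_thetaVal A B C
  have h₀ := hN (sect B (fun _ => 0)) (sect B (fun _ => 1)) (sect B (fun _ => 2)) (sect C (fun _ => 0)) (sect C (fun _ => 1)) (sect C (fun _ => 2))
    (isUpperSet_sect hB _) (isUpperSet_sect hB _) (isUpperSet_sect hB _) (isUpperSet_sect hC _) (isUpperSet_sect hC _) (isUpperSet_sect hC _)
    (sect_subset_sect_of_le' hB (by decide)) (sect_subset_sect_of_le' hB (by decide))
    (sect_subset_sect_of_le' hC (by decide)) (sect_subset_sect_of_le' hC (by decide))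
  simp only [sum_sect_inter_eq', ind_sect] at h₀
  -- d'(B∩C) by levels
  have L2 : (∑ x ∈ B ∩ C, (fun x => if freeOf x 0 = 2 then 2 * h (cellOf x) else 2 * g (cellOf x)) x)
      = 2 * (∑ q : Pd k, ind B (glue (fun _ => 0) q) * ind C (glue (fun _ => 0) q) * g q)
        + 2 * (∑ q : Pd k, ind B (glue (fun _ => 1) q) * ind C (glue (fun _ => 1) q) * g q)
        + 2 * (∑ q : Pd k, ind B (glue (fun _ => 2) q) * ind C (glue (fun _ => 2) q) * h q) := by
    rw [sum_mem_eq_levels]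
    simp only [ind_inter_eq_mul, freeOf_glue, cellOf_glue, show ¬ ((0:Fin 3) = 2) by decide, show ¬ ((1:Fin 3) = 2) by decide,
      if_false, if_true]
    rw [Finset.mul_sum, Finset.mul_sum, Finset.mul_sum]
    congr 1; congr 1
    all_goals (refine Finset.sum_congr rfl fun q _ => ?_; ring)
  -- λ_A(B∩C) by levels, as a pair sum
  have L1 : (∑ x ∈ B ∩ C, lamU A x)
      = ∑ q : Pd k, ∑ r : Pd k, (if TotDist q r = true then (1:ℤ) else 0) *
          ( ind B (glue (fun _ => 0) q) * ind C (glue (fun _ => 0) q) * (4 * ind V₀ q - ind V₀ r - ind V₁ r)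
            + ind B (glue (fun _ => 1) q) * ind C (glue (fun _ => 1) q) * (4 * ind V₀ q - ind V₀ r - ind V₁ r)
            + ind B (glue (fun _ => 2) q) * ind C (glue (fun _ => 2) q) * (4 * ind V₁ q - 2 * ind V₀ r) ) := by
    rw [sum_mem_eq_levels]
    simp only [ind_inter_eq_mul]
    have c4 : ∀ (X : Finset (Pd k)) (q : Pd k), (2:ℤ) * 2 ^ (1 + k) * ind X q = ∑ r : Pd k, (if TotDist q r = true then (1:ℤ) else 0) * (4 * ind X q) := by
      intro X q; rw [← Finset.sum_mul, sum_ite_totDist_eq_two_pow, pow_add, pow_one]; ring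
    have cν : ∀ (X : Finset (Pd k)) (q : Pd k), (∑ r : Pd k, ind X r * (if TotDist r q = true then (1:ℤ) else 0))
        = ∑ r : Pd k, (if TotDist q r = true then (1:ℤ) else 0) * ind X r := by
      intro X q; refine Finset.sum_congr rfl fun r _ => ?_; rw [totDist_symm r q]; ring
    rw [← Finset.sum_add_distrib, ← Finset.sum_add_distrib]
    refine Finset.sum_congr rfl fun q _ => ?_
    rw [(hl q).1, (hl q).2.1, (hl q).2.2, c4 V₀ q, c4 V₁ q, cν V₀ q, cν V₁ q]
    rw [Finset.mul_sum]
    simp only [Finset.mul_sum, ← Finset.sum_sub_distrib, ← Finset.sum_add_distrib]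
    refine Finset.sum_congr rfl fun r _ => ?_
    ring
  have Id := sStarD_relStepRO_eq_sections i0 i1 i2 B C
  rw [L2]
  linarith [Id, L1, eS, h₀]

/-- **A level-wise certificate for the RO step**: if `g, h ≥ 0` satisfy (T⁼) and (N⁼) on `[3]^k`, then `A = glue(V⁰,V⁰,V¹)` and every cylinder `A × [3]^n` are
good first slots (all `n`). [this work] -/
theorem sStarD_cylSet_relStepRO_nonneg (i0 : ∀ z, ind A (glue (fun _ => 0) z) = ind V₀ z) (i1 : ∀ z, ind A (glue (fun _ => 1) z) = ind V₀ z)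
    (i2 : ∀ z, ind A (glue (fun _ => 2) z) = ind V₁ z) (g h : Pd k → ℤ) (hg : ∀ q, 0 ≤ g q) (hh : ∀ q, 0 ≤ h q)
    (hT : ∀ W₀ W₁ W₂ : Finset (Pd k), IsUpperSet (W₀ : Set (Pd k)) → IsUpperSet (W₁ : Set (Pd k)) → IsUpperSet (W₂ : Set (Pd k)) →
      W₀ ⊆ W₁ → W₁ ⊆ W₂ →
      2 * (∑ q ∈ W₀, g q) + 2 * (∑ q ∈ W₁, g q) + 2 * (∑ q ∈ W₂, h q)
        ≤ (∑ q ∈ W₀, (2 * 2 ^ (1 + k) * ind V₀ q - (∑ r : Pd k, ind V₀ r * (if TotDist r q = true then (1:ℤ) else 0))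
              - ∑ r : Pd k, ind V₁ r * (if TotDist r q = true then (1:ℤ) else 0)))
          + (∑ q ∈ W₁, (2 * 2 ^ (1 + k) * ind V₀ q - (∑ r : Pd k, ind V₀ r * (if TotDist r q = true then (1:ℤ) else 0))
              - ∑ r : Pd k, ind V₁ r * (if TotDist r q = true then (1:ℤ) else 0)))
          + (∑ q ∈ W₂, (2 * 2 ^ (1 + k) * ind V₁ q - 2 * ∑ r : Pd k, ind V₀ r * (if TotDist r q = true then (1:ℤ) else 0))))
    (hN : ∀ B₀ B₁ B₂ C₀ C₁ C₂ : Finset (Pd k), IsUpperSet (B₀ : Set (Pd k)) → IsUpperSet (B₁ : Set (Pd k)) → IsUpperSet (B₂ : Set (Pd k)) →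
      IsUpperSet (C₀ : Set (Pd k)) → IsUpperSet (C₁ : Set (Pd k)) → IsUpperSet (C₂ : Set (Pd k)) → B₀ ⊆ B₁ → B₁ ⊆ B₂ → C₀ ⊆ C₁ → C₁ ⊆ C₂ →
      (∑ q : Pd k, ∑ r : Pd k, (if TotDist q r = true then (1:ℤ) else 0) *
          ( ind B₀ q * ind C₁ r * (ind V₀ q + ind V₀ r - ind V₁ (thirdPt q r))
            + ind B₁ q * ind C₀ r * (ind V₀ q + ind V₀ r - ind V₁ (thirdPt q r))
            + ind B₀ q * ind C₂ r * (ind V₀ q + ind V₁ r - ind V₀ (thirdPt q r))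
            + ind B₁ q * ind C₂ r * (ind V₀ q + ind V₁ r - ind V₀ (thirdPt q r))
            + ind B₂ q * ind C₀ r * (ind V₁ q + ind V₀ r - ind V₀ (thirdPt q r))
            + ind B₂ q * ind C₁ r * (ind V₁ q + ind V₀ r - ind V₀ (thirdPt q r)) ))
        ≤ 2 * (∑ q ∈ B₀ ∩ C₀, g q) + 2 * (∑ q ∈ B₁ ∩ C₁, g q) + 2 * (∑ q ∈ B₂ ∩ C₂, h q))
    {n : ℕ} {B C : Finset (Pd (n + (1 + k)))} (hB : IsUpperSet (B : Set (Pd (n + (1 + k))))) (hC : IsUpperSet (C : Set (Pd (n + (1 + k))))) :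
    0 ≤ sStarD (cylSet A : Finset (Pd (n + (1 + k)))) B C :=
  sStarD_cylSet_nonneg_of_diagCert A (fun x => if freeOf x 0 = 2 then 2 * h (cellOf x) else 2 * g (cellOf x))
    (fun x => by
      show 0 ≤ (if freeOf x 0 = 2 then 2 * h (cellOf x) else 2 * g (cellOf x))
      split_ifs
      · exact mul_nonneg (by norm_num) (hh _)
      · exact mul_nonneg (by norm_num) (hg _))
    (fun W' hW' => diagCert_relStepRO_T i0 i1 i2 g h hT W' hW')
    (fun P Q hP hQ => diagCert_relStepRO_N i0 i1 i2 g h hN P Q hP hQ) hB hC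

end Summit.CriticalPhenomena.PercolationContinuityZ3.Theorems.SahiGridPattern
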